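import Literature.NumberTheory.GaloisRepresentations.GaloisRep
import HarnessLib

/-!
# Symplectic Galois representations with a multiplier (`ρ : Γ_K → GSp_n(A)`, similitude `χ`)

Definition item `defn-IsSymplecticWithMultiplier` (route `Langlands/PhantomRM`, items PhantomRMSector,
ResiduallyYoshidaLifting, StableYoshidaCongruence, which so far inline the sub-formula
`∃ J, Jᵀ = -J ∧ det J ≠ 0 ∧ ∀ g, ρ(g)ᵀ J ρ(g) = χ(g) J`).

A framed Galois representation `ρ : Γ_K →ₜ* GL_n(A)` is **symplectic with multiplier (similitude
character) `χ`** if it preserves a non-degenerate alternating form up to the scalar `χ`: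
there is `J ∈ M_n(A)` with `Jᵀ = −J`, `det J ∈ Aˣ` and `ρ(g)ᵀ J ρ(g) = χ(g) J` for all `g ∈ Γ_K` — i.e.
`ρ` lands in `GSp(J) ≅ GSp_n(A)` with `sim ∘ ρ = χ` (Boxer–Calegari–Gee–Pilloni 2021, §2:
`ρ_{A,p} : G_ℚ → GSp₄(ℚ_p)` with similitude the inverse cyclotomic character in the cohomological
convention; Darmon–Diamond–Taylor, §2.1 for `n = 2`, where `GSp₂ = GL₂` and the condition is
`det ρ = χ`, cf. `isSymplecticWithMultiplierFun_two_iff_det`).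

## Design

* Two spellings: `IsSymplecticWithMultiplierFun ρ ν` with a bare multiplier FUNCTION
  `ν : Γ_K → A` (this is what the route's items need: their multiplier is the `p`-adic cyclotomic
  character pushed into `PadicAlgCl p` along `ℤ_[p] → ℚ_[p] → PadicAlgCl p`, an explicit function of
  `g`), and the requested `IsSymplecticWithMultiplier ρ χ` for a continuous character
  `χ : Γ_K →ₜ* Aˣ`, DEFINED as the former at `fun g ↦ (χ g : A)` (`isSymplecticWithMultiplier_iff`).
* Non-degeneracy is `IsUnit J.det` (any commutative coefficient ring, e.g. `𝓞`, `𝔽`); over a field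
  this is the route's `J.det ≠ 0` (`isSymplecticWithMultiplierFun_iff_det_ne_zero`), so the inlined
  sub-formula of PhantomRM is LITERALLY `ρ.IsSymplecticWithMultiplierFun ν` unfolded.
* `n` is not required to be even in the definition (for odd `n` no such `J` exists over a field, so
  the predicate is simply false; nothing forces junk).

## References

* [BoxerEtAl2021] G. Boxer, F. Calegari, T. Gee, V. Pilloni, Abelian surfaces over totally real
  fields are potentially modular, Publ. IHÉS 134 (2021), §2 (notation `GSp₄`, similitude `ν`).
* [DarmonDiamondTaylor1995] H. Darmon, F. Diamond, R. Taylor, Fermat's Last Theorem, §2.1.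
-/

namespace Literature.NumberTheory.GaloisRepresentations

open Field Matrix

universe u v

variable {K : Type u} [Field K] {A : Type v} [CommRing A] [TopologicalSpace A] {n : ℕ}

/-- `ρ : Γ_K →ₜ* GL_n(A)` is **symplectic with multiplier function `ν : Γ_K → A`**: some
`J ∈ M_n(A)` with `Jᵀ = −J` and `det J` a unit satisfies `ρ(g)ᵀ J ρ(g) = ν(g) • J` for all `g`
(`ρ(Γ_K) ⊆ GSp(J)` with similitude `ν`). [cite: BoxerEtAl2021, §2] -/
def FramedGaloisRep.IsSymplecticWithMultiplierFun (ρ : FramedGaloisRep K A n)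
    (ν : absoluteGaloisGroup K → A) : Prop :=
  ∃ J : Matrix (Fin n) (Fin n) A, Jᵀ = -J ∧ IsUnit J.det ∧
    ∀ g : absoluteGaloisGroup K, (ρ g).valᵀ * J * (ρ g).val = ν g • J

/-- `ρ : Γ_K →ₜ* GL_n(A)` is **symplectic with multiplier the continuous character
`χ : Γ_K →ₜ* Aˣ`**: `∃ J, Jᵀ = −J ∧ det J ∈ Aˣ ∧ ∀ g, ρ(g)ᵀ J ρ(g) = χ(g) • J`, i.e. `ρ` lands in
`GSp_n(A)` with similitude character `χ` (Boxer–Calegari–Gee–Pilloni 2021, §2; for `n = 2` the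
condition is `det ρ = χ`, Darmon–Diamond–Taylor §2.1). Defined through the bare-function form
`IsSymplecticWithMultiplierFun` at `g ↦ (χ g : A)`. [cite: BoxerEtAl2021, §2] -/
def FramedGaloisRep.IsSymplecticWithMultiplier (ρ : FramedGaloisRep K A n)
    (χ : absoluteGaloisGroup K →ₜ* Aˣ) : Prop :=
  ρ.IsSymplecticWithMultiplierFun fun g => ((χ g : Aˣ) : A)

/-- Unfolding: the requested formula verbatim. [cite: BoxerEtAl2021, §2] -/
theorem FramedGaloisRep.isSymplecticWithMultiplier_iff (ρ : FramedGaloisRep K A n)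
    (χ : absoluteGaloisGroup K →ₜ* Aˣ) :
    ρ.IsSymplecticWithMultiplier χ ↔
      ∃ J : Matrix (Fin n) (Fin n) A, Jᵀ = -J ∧ IsUnit J.det ∧
        ∀ g : absoluteGaloisGroup K, (ρ g).valᵀ * J * (ρ g).val = ((χ g : Aˣ) : A) • J :=
  Iff.rfl

/-- Over a FIELD of coefficients the non-degeneracy clause reads `det J ≠ 0`: this is literally
the sub-formula inlined in the items of route `Langlands/PhantomRM`. [cite: BoxerEtAl2021, §2] -/
theorem FramedGaloisRep.isSymplecticWithMultiplierFun_iff_det_ne_zero {L : Type v} [Field L]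
    [TopologicalSpace L] (ρ : FramedGaloisRep K L n) (ν : absoluteGaloisGroup K → L) :
    ρ.IsSymplecticWithMultiplierFun ν ↔
      ∃ J : Matrix (Fin n) (Fin n) L, Jᵀ = -J ∧ J.det ≠ 0 ∧
        ∀ g : absoluteGaloisGroup K, (ρ g).valᵀ * J * (ρ g).val = ν g • J := by
  simp only [FramedGaloisRep.IsSymplecticWithMultiplierFun, isUnit_iff_ne_zero]

/-- The multiplier only matters through its values: equal multiplier functions give the same
predicate (used to move between a character and its explicit formula). [folklore] -/
theorem FramedGaloisRep.isSymplecticWithMultiplierFun_congr (ρ : FramedGaloisRep K A n)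
    {ν ν' : absoluteGaloisGroup K → A} (h : ∀ g, ν g = ν' g) :
    ρ.IsSymplecticWithMultiplierFun ν ↔ ρ.IsSymplecticWithMultiplierFun ν' := by
  simp only [FramedGaloisRep.IsSymplecticWithMultiplierFun, funext h]

/-- The Gram matrix may be rescaled by a unit `u ∈ Aˣ` without changing the multiplier (the
alternating form is determined up to `Aˣ`). [cite: BoxerEtAl2021, §2] -/
theorem FramedGaloisRep.IsSymplecticWithMultiplierFun.exists_smul {ρ : FramedGaloisRep K A n}
    {ν : absoluteGaloisGroup K → A} (h : ρ.IsSymplecticWithMultiplierFun ν) (u : Aˣ) :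
    ∃ J : Matrix (Fin n) (Fin n) A, Jᵀ = -J ∧ IsUnit J.det ∧
      (∀ g : absoluteGaloisGroup K, (ρ g).valᵀ * J * (ρ g).val = ν g • J) ∧
      ρ.IsSymplecticWithMultiplierFun ν ∧ ∃ J₀, J = (u : A) • J₀ := by
  obtain ⟨J₀, hT, hdet, hJ⟩ := h
  refine ⟨(u : A) • J₀, ?_, ?_, fun g ↦ ?_, ⟨J₀, hT, hdet, hJ⟩, J₀, rfl⟩
  · rw [transpose_smul, hT, smul_neg]
  · rw [det_smul]
    exact (u.isUnit.pow _).mul hdet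
  · rw [Matrix.mul_smul, Matrix.smul_mul, hJ g, smul_comm]

/-- In rank `2` (`GSp₂ = GL₂`), with the standard form `J = !![0, 1; -1, 0]`, the condition
`ρ(g)ᵀ J ρ(g) = ν(g) J` is `det ρ(g) = ν(g)`: every rank-2 representation is symplectic with
multiplier its determinant (Darmon–Diamond–Taylor §2.1). [cite: DarmonDiamondTaylor1995, §2.1] -/
theorem FramedGaloisRep.isSymplecticWithMultiplierFun_two_det (ρ : FramedGaloisRep K A 2) :
    ρ.IsSymplecticWithMultiplierFun fun g => (ρ g).val.det := by
  refine ⟨!![0, 1; -1, 0], ?_, ?_, fun g ↦ ?_⟩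
  · ext i j; fin_cases i <;> fin_cases j <;> simp
  · simp [Matrix.det_fin_two]
  · ext i j
    fin_cases i <;> fin_cases j <;>
      simp [Matrix.det_fin_two, Matrix.mul_apply, Fin.sum_univ_two, Matrix.transpose_apply] <;> ring

end Literature.NumberTheory.GaloisRepresentations
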